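import Literature.NumberTheory.Automorphic.RegularAlgebraicCuspidalHeckePoint
import Literature.NumberTheory.Automorphic.CompletedCohomologyPoints
import Mathlib.Algebra.FreeAlgebra
import Mathlib.RingTheory.Valuation.Integers
import Mathlib.RepresentationTheory.Homological.GroupCohomology.LowDegree
import HarnessLib

/-!
# Points of `Spf 𝕋(Kᵖ)` from classical eigen-data: the continuity step of Emerton–Scholze

Topic `NumberTheory/Automorphic`, namespace `Literature.NumberTheory.Automorphic`.  Proofs-only
sibling (theorems, no definitions, no named facts) of `RegularAlgebraicCuspidalHeckePoint`, whose
named fact `bianchi_regularAlgebraicCuspidal_isHeckePoint` asserts that the Hecke eigensystem of a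
regular algebraic cuspidal `π` on `GL₂` over an imaginary quadratic field is an `𝒪_{ℚ̄_p}`-point of
the big Hecke algebra `𝕋(U₀ᵖ)` of the `p`-power tower (`IsHeckePoint`).  The printed proof
([Scholze2015, §V.4, proofs of Thm. V.4.1 and Cor. V.4.2]; [Emerton2006, §2.2–2.3];
[CalegariEmerton2011, §8]) has an automorphic half — Eichler–Shimura–Harder: the eigensystem occurs
on a NON-ZERO class of some `H^q(X_{U₀}, ξ̃)`, integrally after choosing a lattice — and an
algebraic half, the CONTINUITY STEP: "the kernel of `𝕋_{F,S} → 𝕋_{F,S}(K, ξ, i)` is contained in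
the kernel of `𝕋_{F,S} → ∏_m 𝕋_{F,S}(K, ξ, i, m)` … `θ(T)^{q+1} = 0`, hence `θ(T) = 0`, whenever `T`
acts as zero on all `H^b(X_{U_r}, ℤ/p^s)`, and the same estimate at finite `s` makes `θ`
continuous".  This file proves the algebraic half once and for all, in the generic vocabulary of
`CompletedCohomology` (`LevelTower`, `towerHeckeFamily`, `bigHeckeAlgebra`, `IsHeckePoint`), for an
arbitrary coefficient ring `k`, tower `T`, Hecke elements `δ : J → 𝒢` and eigenvalues `χ : J → k`:

* `isHeckePoint_iff_forall_freeAlgebra` — **`χ` is a point of `Spf 𝕋(Kᵖ)` iff, for every `t`,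
  there is a finite set `I` of pieces `H^i(X_{K(s)}, k/ϖ^{t'})` such that every non-commutative
  polynomial `P` in the `T_{δ j}` acting as zero on all pieces of `I` has `P(χ) ∈ (ϖ^t)`** (the
  abstract Hecke algebra is the free `k`-algebra on `J`, `FreeAlgebra k J`; its image acting
  diagonally is `towerHeckeAlgebra`, `towerHeckeAlgebra_eq_range_lift`).  This is the precise form
  of "`θ` kills the kernel of `𝕋 → 𝕋_I`, hence extends continuously to the closure `𝕋(Kᵖ)`".
* `lift_smul_eq_of_eigenvector`, `lift_mem_span_of_eigenvector` — on a simultaneous eigenvector `c`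
  of endomorphisms `S_j` of ANY `k`-module `H` (a classical cohomology group `H^q(X_{U₀}, M/p^{t'})`
  in the application) the free algebra acts through the character `P ↦ P(χ)`; if the annihilator of
  `c` lies in `(ϖ^{t'})`, if `a^N ∈ (ϖ^{t'}) ⇒ a ∈ (ϖ^t)` in `k`, and if `P^N c = 0`, then
  `P(χ) ∈ (ϖ^t)` (Scholze's "`θ(T)^{N} = 0` hence `θ(T) = 0` modulo `p^t`").
* `isHeckePoint_of_nilpotentControl` — hence: if for every `t` some eigenvector `c` as above is
  NILPOTENTLY CONTROLLED by finitely many pieces of the tower (every `P` vanishing on the pieces of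
  `I` has `P^N c = 0`: the output of the Hochschild–Serre spectral sequence
  `H^a(U₀/U_r, H^b(X_{U_r}, M/p^{t'})) ⇒ H^{a+b}(X_{U₀}, M̃/p^{t'})`, `N = q + 1`), then `χ` is a
  point of `Spf 𝕋(Kᵖ)`.
* `isHeckePoint_of_towerEigenclass` — the case `N = 1`, `H` a piece of the tower: torsion
  eigenclasses `c_t ∈ H^i(X_{K(s)}, k/ϖ^{t'})` whose annihilators lie in `(ϖ^t)` give a point
  (generalises `EigensystemOccurs.isHeckePoint` of `CompletedCohomologyPoints`, where the
  annihilator had to be exactly `(ϖ^{t+1})`; the slack `t' ≥ t` is what reduction of a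
  characteristic-`0` eigenclass of positive `ϖ`-adic content produces).
* `eigenvector_map_of_comm`, `annihilator_reduction_le_span_pow` — the reduction bookkeeping: a
  Hecke-equivariant `red : L → H` with kernel in `ϖ^{t'} L` (reduction `H^q(X_U, M) → H^q(X_U, M/ϖ^{t'})`)
  maps an integral eigenclass `c` to an eigenclass whose annihilator lies in `(ϖ^t)` as soon as
  `t' ≥ t + m`, `m` bounding the `ϖ`-adic content of `c` along some linear functional.
* `mem_span_pow_of_pow_mem_span_pow` — in the ring of integers of a valuation (e.g.
  `k = 𝒪_{ℚ̄_p}`, the coefficient ring of the named fact) `a^N ∈ (ϖ^{t'})` with `N t ≤ t'`, `N ≠ 0`,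
  implies `a ∈ (ϖ^t)`; `isHeckePoint_of_nilpotentControl_of_integers` is the resulting form of the
  continuity step over such `k`, with the printed bookkeeping `t' ≥ N t`.

* `ArithmeticQuotient.exists_cohomology_zero_smul_eq_zero_iff`, `isHeckePoint_of_isEmpty` — the
  class of a constant function in `H⁰(X_L, M)` has the annihilator of its value, so that for an
  EMPTY family of Hecke generators every `χ` is a point as soon as `ϖ` is not a unit; whence
  `bianchi_regularAlgebraicCuspidal_isHeckePoint_of_zero_mem`, the degenerate case `0 ∈ S₀` (no
  good place) of the named fact, for `U₀ = GL₂(𝒪̂_K)` (`not_isUnit_natCast_valuationSubring_padicAlgCl`: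
  `p` is not a unit of `𝒪_{ℚ̄_p}`).

What remains for `bianchi_regularAlgebraicCuspidal_isHeckePoint_holds` is therefore exactly the
automorphic half (Eichler–Shimura–Harder with a lattice, and the comparison of the twisted
algebraic local system modulo `p^{t'}` with trivial coefficients deep in the tower), not in the
tree at the time of writing; no named fact is introduced here (D-0026).

## References

* P. Scholze, *On torsion in the cohomology of locally symmetric varieties*, Ann. of Math. 182
  (2015), §V.4, proofs of Thm. V.4.1 and Cor. V.4.2 (arXiv:1306.2070, pp. 66–67) [Scholze2015].
* M. Emerton, *On the interpolation of systems of eigenvalues attached to automorphic Hecke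
  eigenforms*, Invent. Math. 164 (2006), §2.2–2.3 [Emerton2006].
* F. Calegari, M. Emerton, *Completed cohomology — a survey* (2012), §8 [CalegariEmerton2011].
-/

noncomputable section

universe u v w

namespace Literature.NumberTheory.Automorphic

variable {k : Type u} [CommRing k] {Γ 𝒢 : Type u} [Group Γ] [Group 𝒢]
variable {ι : Γ →* 𝒢} {T : LevelTower 𝒢} {ϖ : k} {J : Type v} {δ : J → 𝒢} {χ : J → k}

/-! ### The abstract Hecke algebra `k⟨T_j : j ∈ J⟩` and its diagonal action on the tower -/

variable (k ι T ϖ δ) in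
/-- The dense subalgebra `towerHeckeAlgebra` of `𝕋(Kᵖ)` is the image of the abstract Hecke algebra
(the free `k`-algebra on the symbols `T_j`, `j ∈ J`) acting diagonally on
`⊕_{i,s,t} H^i(X_{K(s)}, k/ϖ^t)` through `T_j ↦ (T_{δ j})_{i,s,t}`. [folklore] -/
theorem towerHeckeAlgebra_eq_range_lift :
    towerHeckeAlgebra k ι T ϖ δ =
      (FreeAlgebra.lift k fun j => towerHeckeFamily k ι T ϖ (δ j)).range :=
  Algebra.adjoin_range_eq_range_freeAlgebra_lift k J fun j => towerHeckeFamily k ι T ϖ (δ j)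

variable (k ι T ϖ δ) in
/-- `towerHeckeAlgebra ≤ bigHeckeAlgebra` (the big Hecke algebra is its closure). [folklore] -/
theorem towerHeckeAlgebra_le_bigHeckeAlgebra :
    towerHeckeAlgebra k ι T ϖ δ ≤ bigHeckeAlgebra k ι T ϖ δ :=
  fun x hx _ => ⟨x, hx, fun _ _ => rfl⟩

variable (k ι T ϖ δ) in
/-- The image of an abstract Hecke operator `P ∈ k⟨T_j⟩` acting on the tower lies in the big Hecke
algebra. [folklore] -/
theorem lift_mem_bigHeckeAlgebra (P : FreeAlgebra k J) :
    FreeAlgebra.lift k (fun j => towerHeckeFamily k ι T ϖ (δ j)) P ∈ bigHeckeAlgebra k ι T ϖ δ :=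
  towerHeckeAlgebra_le_bigHeckeAlgebra k ι T ϖ δ
    ((towerHeckeAlgebra_eq_range_lift k ι T ϖ δ).symm ▸ AlgHom.mem_range_self _ P)

variable (k ι T ϖ δ) in
/-- The abstract Hecke algebra mapping to the big Hecke algebra, `T_j ↦ (T_{δ j})_{i,s,t}`, has
underlying family `FreeAlgebra.lift` of the diagonal Hecke families. [folklore] -/
theorem val_lift_bigHeckeAlgebra (P : FreeAlgebra k J) :
    ((FreeAlgebra.lift k fun j =>
        (⟨towerHeckeFamily k ι T ϖ (δ j), towerHeckeFamily_mem_bigHeckeAlgebra k ι T ϖ δ j⟩ :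
          bigHeckeAlgebra k ι T ϖ δ)) P).1 =
      FreeAlgebra.lift k (fun j => towerHeckeFamily k ι T ϖ (δ j)) P := by
  change ((bigHeckeAlgebra k ι T ϖ δ).val.comp (FreeAlgebra.lift k fun j =>
      (⟨towerHeckeFamily k ι T ϖ (δ j), towerHeckeFamily_mem_bigHeckeAlgebra k ι T ϖ δ j⟩ :
        bigHeckeAlgebra k ι T ϖ δ))) P = _
  congr 1
  refine FreeAlgebra.hom_ext (funext fun j => ?_)
  simp only [Function.comp_apply, AlgHom.comp_apply, FreeAlgebra.lift_ι_apply, Subalgebra.coe_val]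

/-- A `k`-algebra homomorphism `φ : 𝕋(Kᵖ) → k/ϖ^t` with `φ(T_{δ j}) = χ j` takes the value
`P(χ) mod ϖ^t` on the image of every abstract Hecke operator `P ∈ k⟨T_j⟩`. [folklore] -/
theorem algHom_lift_eq_mk {t : ℕ} (φ : bigHeckeAlgebra k ι T ϖ δ →ₐ[k] modPow k ϖ t)
    (hφ : ∀ j, φ ⟨towerHeckeFamily k ι T ϖ (δ j), towerHeckeFamily_mem_bigHeckeAlgebra k ι T ϖ δ j⟩ =
      Ideal.Quotient.mk _ (χ j))
    (P : FreeAlgebra k J) :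
    φ ((FreeAlgebra.lift k fun j =>
        (⟨towerHeckeFamily k ι T ϖ (δ j), towerHeckeFamily_mem_bigHeckeAlgebra k ι T ϖ δ j⟩ :
          bigHeckeAlgebra k ι T ϖ δ)) P) =
      Ideal.Quotient.mk (Ideal.span {ϖ ^ t}) (FreeAlgebra.lift k χ P) := by
  change (φ.comp (FreeAlgebra.lift k fun j =>
      (⟨towerHeckeFamily k ι T ϖ (δ j), towerHeckeFamily_mem_bigHeckeAlgebra k ι T ϖ δ j⟩ :
        bigHeckeAlgebra k ι T ϖ δ))) P =
    ((Ideal.Quotient.mkₐ k (Ideal.span {ϖ ^ t})).comp (FreeAlgebra.lift k χ)) P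
  congr 1
  refine FreeAlgebra.hom_ext (funext fun j => ?_)
  simp only [Function.comp_apply, AlgHom.comp_apply, FreeAlgebra.lift_ι_apply,
    Ideal.Quotient.mkₐ_eq_mk, hφ j]

/-! ### Points of `Spf 𝕋(Kᵖ)` = characters killing the kernels of the finite-level actions -/

/-- **`χ` is a point of `Spf 𝕋(Kᵖ)` iff `χ mod ϖ^t` kills, for every `t`, the kernel of the action
of the abstract Hecke algebra on finitely many pieces of the tower.**  Precisely:
`IsHeckePoint ι T ϖ δ χ` holds iff for every `t` there is a finite set `I` of indices `(i, s, t')`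
such that every `P` in the free `k`-algebra on `J` whose diagonal action `P((T_{δ j})_j)` vanishes
on `H^i(X_{K(s)}, k/ϖ^{t'})` for all `(i, s, t') ∈ I` satisfies `P(χ) ∈ (ϖ^t)`.  (`⇒`: a continuous
`φ` factoring through `I` has `φ(P) = φ(0) = 0` and `φ(P) = P(χ) mod ϖ^t`.  `⇐`: every `x ∈ 𝕋(Kᵖ)`
agrees on `I` with some `P((T_{δ j})_j)`, and `x ↦ P(χ) mod ϖ^t` is well defined, multiplicative and
continuous.)  This is the continuity mechanism of [Scholze2015, §V.4, proof of Cor. V.4.2] ("the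
kernel of `𝕋_{F,S} → 𝕋_{F,S}(K,ξ,i)` is contained in the kernel of `𝕋_{F,S} → ∏_m 𝕋_{F,S}(K,ξ,i,m)`")
and of [Emerton2006, §2.3]. [cite: Scholze2015, §V.4, proof of Cor. V.4.2] [cite: CalegariEmerton2011, §8] -/
theorem isHeckePoint_iff_forall_freeAlgebra :
    IsHeckePoint ι T ϖ δ χ ↔
      ∀ t : ℕ, ∃ I : Finset TowerIndex, ∀ P : FreeAlgebra k J,
        (∀ z ∈ I, FreeAlgebra.lift k (fun j => towerHeckeFamily k ι T ϖ (δ j)) P z = 0) →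
          FreeAlgebra.lift k χ P ∈ Ideal.span {ϖ ^ t} := by
  constructor
  · intro h t
    obtain ⟨I, φ, hcont, hval⟩ := h t
    refine ⟨I, fun P hP => ?_⟩
    rw [← Ideal.Quotient.eq_zero_iff_mem, ← algHom_lift_eq_mk φ hval P, ← map_zero φ]
    refine hcont _ _ fun z hz => ?_
    rw [val_lift_bigHeckeAlgebra, hP z hz]
    rfl
  · intro h t
    obtain ⟨I, hI⟩ := h t
    -- every element of the big Hecke algebra agrees on `I` with an abstract Hecke operator
    have hex : ∀ x : bigHeckeAlgebra k ι T ϖ δ, ∃ P : FreeAlgebra k J,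
        ∀ z ∈ I, x.1 z = FreeAlgebra.lift k (fun j => towerHeckeFamily k ι T ϖ (δ j)) P z := by
      intro x
      obtain ⟨a, ha, hxa⟩ := x.2 I
      rw [towerHeckeAlgebra_eq_range_lift] at ha
      obtain ⟨P, rfl⟩ := ha
      exact ⟨P, hxa⟩
    choose rep hrep using hex
    -- well-definedness: the value `P(χ) mod ϖ^t` only depends on the restriction to `I`
    have hwd : ∀ (x : bigHeckeAlgebra k ι T ϖ δ) (P : FreeAlgebra k J),
        (∀ z ∈ I, x.1 z = FreeAlgebra.lift k (fun j => towerHeckeFamily k ι T ϖ (δ j)) P z) →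
          Ideal.Quotient.mk (Ideal.span {ϖ ^ t}) (FreeAlgebra.lift k χ (rep x)) =
            Ideal.Quotient.mk (Ideal.span {ϖ ^ t}) (FreeAlgebra.lift k χ P) := by
      intro x P hP
      rw [Ideal.Quotient.eq, ← map_sub]
      refine hI _ fun z hz => ?_
      rw [map_sub, Pi.sub_apply, ← hrep x z hz, ← hP z hz, sub_self]
    refine ⟨I,
      { toFun := fun x => Ideal.Quotient.mk (Ideal.span {ϖ ^ t}) (FreeAlgebra.lift k χ (rep x))
        map_one' := ?_
        map_mul' := fun x y => ?_
        map_zero' := ?_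
        map_add' := fun x y => ?_
        commutes' := fun r => ?_ }, fun x y hxy => ?_, fun j => ?_⟩
    · rw [hwd 1 1 fun z _ => by rw [map_one]; rfl, map_one, map_one]
    · rw [← map_mul, ← map_mul]
      refine hwd (x * y) (rep x * rep y) fun z hz => ?_
      rw [map_mul, Pi.mul_apply, ← hrep x z hz, ← hrep y z hz]
      rfl
    · rw [hwd 0 0 fun z _ => by rw [map_zero]; rfl, map_zero, map_zero]
    · rw [← map_add, ← map_add]
      refine hwd (x + y) (rep x + rep y) fun z hz => ?_
      rw [map_add, Pi.add_apply, ← hrep x z hz, ← hrep y z hz]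
      rfl
    · refine (hwd (algebraMap k _ r) (algebraMap k _ r) fun z _ => by
        rw [AlgHom.commutes]; rfl).trans ?_
      rw [AlgHom.commutes]
      rfl
    · change Ideal.Quotient.mk _ (FreeAlgebra.lift k χ (rep x)) =
        Ideal.Quotient.mk _ (FreeAlgebra.lift k χ (rep y))
      exact hwd x (rep y) fun z hz => (hxy z hz).trans (hrep y z hz)
    · change Ideal.Quotient.mk _ (FreeAlgebra.lift k χ (rep _)) = _
      rw [hwd _ (FreeAlgebra.ι k j) fun z _ => by rw [FreeAlgebra.lift_ι_apply],
        FreeAlgebra.lift_ι_apply]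

/-! ### Eigenvectors: the abstract Hecke algebra acts through the character `P ↦ P(χ)` -/

section Eigenvector

variable {H : Type w} [AddCommGroup H] [Module k H]

/-- On a simultaneous eigenvector `c` of endomorphisms `S_j` with eigenvalues `χ j`, every element
`P` of the free algebra acts by the scalar `P(χ)`: `P((S_j)_j) c = P(χ) • c`. [folklore] -/
theorem lift_smul_eq_of_eigenvector (S : J → Module.End k H) {c : H} (hc : ∀ j, S j c = χ j • c)
    (P : FreeAlgebra k J) : FreeAlgebra.lift k S P c = FreeAlgebra.lift k χ P • c := by
  induction P using FreeAlgebra.induction with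
  | grade0 r =>
    rw [AlgHom.commutes, AlgHom.commutes, Module.algebraMap_end_apply, Algebra.algebraMap_self,
      RingHom.id_apply]
  | grade1 j => rw [FreeAlgebra.lift_ι_apply, FreeAlgebra.lift_ι_apply, hc j]
  | mul a b ha hb =>
    rw [map_mul, map_mul, Module.End.mul_apply, hb, map_smul, ha, smul_smul, mul_comm]
  | add a b ha hb => rw [map_add, map_add, LinearMap.add_apply, ha, hb, add_smul]

/-- Powers: `P((S_j)_j)^N c = P(χ)^N • c` on a simultaneous eigenvector. [folklore] -/
theorem lift_pow_smul_eq_of_eigenvector (S : J → Module.End k H) {c : H}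
    (hc : ∀ j, S j c = χ j • c) (P : FreeAlgebra k J) (N : ℕ) :
    (FreeAlgebra.lift k S P ^ N) c = FreeAlgebra.lift k χ P ^ N • c := by
  induction N with
  | zero => rw [pow_zero, pow_zero, Module.End.one_apply, one_smul]
  | succ N ih =>
    rw [pow_succ, Module.End.mul_apply, lift_smul_eq_of_eigenvector S hc, map_smul, ih, smul_smul,
      ← pow_succ']

/-- **Scholze's estimate "`θ(T)^N = 0`, hence `θ(T) = 0` modulo `ϖ^t`".**  Let `c` be a
simultaneous eigenvector (eigenvalues `χ`) whose annihilator in `k` lies in `(ϖ^{t'})`, and suppose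
`a^N ∈ (ϖ^{t'}) ⇒ a ∈ (ϖ^t)` in `k` (e.g. `k` the integers of a valuation and `N t ≤ t'`,
`mem_span_pow_of_pow_mem_span_pow`).  If an abstract Hecke operator `P` acts nilpotently on `c`,
`P^N c = 0`, then `P(χ) ∈ (ϖ^t)`. [cite: Scholze2015, §V.4, proof of Cor. V.4.2] -/
theorem lift_mem_span_of_eigenvector (S : J → Module.End k H) {c : H}
    (hc : ∀ j, S j c = χ j • c) {N t t' : ℕ}
    (hann : ∀ a : k, a • c = 0 → a ∈ Ideal.span {ϖ ^ t'})
    (hrad : ∀ a : k, a ^ N ∈ Ideal.span {ϖ ^ t'} → a ∈ Ideal.span {ϖ ^ t})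
    {P : FreeAlgebra k J} (hP : (FreeAlgebra.lift k S P ^ N) c = 0) :
    FreeAlgebra.lift k χ P ∈ Ideal.span {ϖ ^ t} := by
  refine hrad _ (hann _ ?_)
  rw [← lift_pow_smul_eq_of_eigenvector S hc P N, hP]

end Eigenvector

/-! ### Points from nilpotently controlled classical eigenvectors -/

/-- **Emerton–Scholze continuity: nilpotently controlled eigenvectors give a point of
`Spf 𝕋(Kᵖ)`.**  Suppose that for every `t` there are a `k`-module `H` (in the application a
classical cohomology group `H^q(X_{U₀}, M̃/p^{t'})` with the coefficients of an algebraic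
representation), endomorphisms `S_j` of `H` (its Hecke operators `T_{δ j}`) with a simultaneous
eigenvector `c` of eigenvalues `χ j` whose annihilator lies in `(ϖ^{t'})`, exponents `N, t'` with
`a^N ∈ (ϖ^{t'}) ⇒ a ∈ (ϖ^t)` in `k`, and a finite set `I` of pieces `H^i(X_{K(s)}, k/ϖ^{t''})` of the
tower CONTROLLING `H` NILPOTENTLY: every abstract Hecke operator `P` acting as zero on the pieces of
`I` satisfies `P^N c = 0` (for `H^q(X_{U₀}, M̃/p^{t'})` and the pieces `H^b(X_{U_r}, 𝒪/p^{t'})`,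
`b ≤ q`, `U_r` deep enough to trivialise `M/p^{t'}`, this with `N = q + 1` is what the
Hecke-equivariant Hochschild–Serre spectral sequence
`H^a(U₀/U_r, H^b(X_{U_r}, M/p^{t'})) ⇒ H^{a+b}(X_{U₀}, M̃/p^{t'})` provides,
[cite: Scholze2015, §V.4, proof of Thm. V.4.1]).  Then `χ` is a point of `Spf 𝕋(Kᵖ)`
(`IsHeckePoint`): `T_{δ j} ↦ χ j` extends for every `t` to a continuous `k`-algebra homomorphism
`𝕋(Kᵖ) → k/ϖ^t`. [cite: Scholze2015, §V.4, proofs of Thm. V.4.1 and Cor. V.4.2]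
[cite: Emerton2006, §2.2 and §2.3] [cite: CalegariEmerton2011, §8] -/
theorem isHeckePoint_of_nilpotentControl
    (h : ∀ t : ℕ, ∃ (I : Finset TowerIndex) (N t' : ℕ) (H : Type w) (_ : AddCommGroup H)
      (_ : Module k H) (S : J → Module.End k H) (c : H),
        (∀ j, S j c = χ j • c) ∧
        (∀ a : k, a • c = 0 → a ∈ Ideal.span {ϖ ^ t'}) ∧
        (∀ a : k, a ^ N ∈ Ideal.span {ϖ ^ t'} → a ∈ Ideal.span {ϖ ^ t}) ∧
        ∀ P : FreeAlgebra k J,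
          (∀ z ∈ I, FreeAlgebra.lift k (fun j => towerHeckeFamily k ι T ϖ (δ j)) P z = 0) →
            (FreeAlgebra.lift k S P ^ N) c = 0) :
    IsHeckePoint ι T ϖ δ χ := by
  rw [isHeckePoint_iff_forall_freeAlgebra]
  intro t
  obtain ⟨I, N, t', H, _, _, S, c, hc, hann, hrad, hI⟩ := h t
  exact ⟨I, fun P hP => lift_mem_span_of_eigenvector S hc hann hrad (hI P hP)⟩

/-- **Torsion eigenclasses in the tower, with slack, give a point of `Spf 𝕋(Kᵖ)`.**  If for every
`t` some piece `H^i(X_{K(s)}, k/ϖ^{t'})` of the tower carries a simultaneous Hecke eigenclass `c`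
with eigenvalues `χ` whose annihilator in `k` lies in `(ϖ^t)` (e.g. the reduction modulo `ϖ^{t'}`,
`t' ≥ t + (content of c₀)`, of a characteristic-`0` eigenclass `c₀` which is not `ϖ`-power
torsion), then `χ` is a point of `Spf 𝕋(Kᵖ)`.  (Generalises `EigensystemOccurs.isHeckePoint`, where
the annihilator is exactly `(ϖ^{t+1})`; the case `N = 1`, `H = H^i(X_{K(s)}, k/ϖ^{t'})`,
`I = {(i, s, t')}` of `isHeckePoint_of_nilpotentControl`.) [cite: CalegariEmerton2011, §8] -/
theorem isHeckePoint_of_towerEigenclass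
    (h : ∀ t : ℕ, ∃ (i s t' : ℕ) (c : towerCohomology k ι T ϖ i s t'),
      ArithmeticQuotient.IsHeckeEigenclass ι (T.level s) (modPow k ϖ t') δ χ i c ∧
        ∀ a : k, a • c = 0 → a ∈ Ideal.span {ϖ ^ t}) :
    IsHeckePoint ι T ϖ δ χ := by
  refine isHeckePoint_of_nilpotentControl.{u, v, u} fun t => ?_
  obtain ⟨i, s, t', c, hc, hann⟩ := h t
  refine ⟨{(i, s, t')}, 1, t, towerCohomology k ι T ϖ i s t', inferInstance, inferInstance,
    fun j => towerHeckeFamily k ι T ϖ (δ j) (i, s, t'), c, hc.2, hann,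
    fun a ha => by rwa [pow_one] at ha, fun P hP => ?_⟩
  -- the action on the single piece `(i, s, t')` is the `(i, s, t')`-component of the diagonal action
  have hcomp : (FreeAlgebra.lift k fun j => towerHeckeFamily k ι T ϖ (δ j) (i, s, t')) =
      (Pi.evalAlgHom k (fun x : TowerIndex => Module.End k (towerCohomology k ι T ϖ x.1 x.2.1 x.2.2))
        (i, s, t')).comp (FreeAlgebra.lift k fun j => towerHeckeFamily k ι T ϖ (δ j)) := by
    refine FreeAlgebra.hom_ext (funext fun j => ?_)
    simp only [Function.comp_apply, AlgHom.comp_apply, FreeAlgebra.lift_ι_apply]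
    rfl
  rw [pow_one, hcomp, AlgHom.comp_apply]
  change (FreeAlgebra.lift k (fun j => towerHeckeFamily k ι T ϖ (δ j)) P) (i, s, t') c = 0
  rw [hP _ (Finset.mem_singleton_self _), LinearMap.zero_apply]

/-! ### Reduction of an integral eigenclass modulo `ϖ^{t'}`: the annihilator bound -/

section Reduction

variable {L H : Type w} [AddCommGroup L] [Module k L] [AddCommGroup H] [Module k H]

/-- Hecke-equivariant maps carry simultaneous eigenvectors to simultaneous eigenvectors with the
same eigenvalues (reduction modulo `ϖ^{t'}`, change of level or of coefficients). [folklore] -/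
theorem eigenvector_map_of_comm (S : J → Module.End k L) (S' : J → Module.End k H)
    (red : L →ₗ[k] H) (hred : ∀ j, red ∘ₗ S j = S' j ∘ₗ red) {c : L} (hc : ∀ j, S j c = χ j • c)
    (j : J) : S' j (red c) = χ j • red c := by
  rw [← LinearMap.comp_apply, ← hred j, LinearMap.comp_apply, hc j, map_smul]

/-- **Annihilator of the reduction of an integral class.**  Let `red : L → H` be `k`-linear with
kernel inside `ϖ^{t'} L` (in the application the reduction
`H^q(X_U, M) → H^q(X_U, M/ϖ^{t'})`, whose kernel is `ϖ^{t'} H^q(X_U, M)` by the long exact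
sequence of `0 → M → M → M/ϖ^{t'} → 0`), let `lam : L → k` be a `k`-linear functional and `c ∈ L` a
class of "`ϖ`-adic content at most `m` along `lam`", `lam(c) ∣ ϖ^m`, with `ϖ^m` a non-zero-divisor.
If `t + m ≤ t'`, the annihilator in `k` of the reduction `red c` lies in `(ϖ^t)`:
`a · red c = 0 ⇒ a c = ϖ^{t'} y ⇒ a lam(c) = ϖ^{t'} lam(y) ⇒ a ϖ^m ∈ ϖ^{t'} k ⇒ a ∈ (ϖ^{t'-m})`.
This is the integrality/reduction bookkeeping of [Scholze2015, §V.4, proof of Cor. V.4.2] ("the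
eigensystem occurs in the finitely generated module `H^q(X_U, M̃)`, so is integral", then reduce),
isolating what the slack `t' - t` has to absorb. [cite: Scholze2015, §V.4, proof of Cor. V.4.2] -/
theorem annihilator_reduction_le_span_pow (red : L →ₗ[k] H) {t' : ℕ}
    (hker : ∀ x : L, red x = 0 → ∃ y : L, x = ϖ ^ t' • y) (lam : L →ₗ[k] k) {c : L} {m t : ℕ}
    (hlam : lam c ∣ ϖ ^ m) (hreg : IsLeftRegular (ϖ ^ m)) (ht : t + m ≤ t') {a : k}
    (ha : a • red c = 0) : a ∈ Ideal.span {ϖ ^ t} := by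
  rw [← map_smul] at ha
  obtain ⟨y, hy⟩ := hker _ ha
  obtain ⟨u, hu⟩ := hlam
  have key : ϖ ^ m * a = ϖ ^ m * (ϖ ^ (t' - m) * (lam y * u)) := by
    have h1 : a * lam c = ϖ ^ t' * lam y := by rw [← smul_eq_mul, ← map_smul, hy, map_smul, smul_eq_mul]
    have h2 : t' = m + (t' - m) := by omega
    calc ϖ ^ m * a = a * lam c * u := by rw [mul_assoc, ← hu, mul_comm]
      _ = ϖ ^ t' * lam y * u := by rw [h1]
      _ = ϖ ^ m * (ϖ ^ (t' - m) * (lam y * u)) := by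
        conv_lhs => rw [h2, pow_add]
        simp only [mul_assoc]
  have ha' : a = ϖ ^ (t' - m) * (lam y * u) := hreg key
  rw [Ideal.mem_span_singleton, ha']
  exact (pow_dvd_pow ϖ (by omega : t ≤ t' - m)).mul_right _

end Reduction

/-! ### The radical estimate in the integers of a valuation (`k = 𝒪_E`, `𝒪_{ℚ̄_p}`, …) -/

/-- In the ring of integers `O` of a valuation (`𝒪_E`, `ℤ̄_p = 𝒪_{ℚ̄_p}`, …), divisibility is
decided by the valuation, so `a^N ∈ (ϖ^{t'})` with `N t ≤ t'` and `N ≠ 0` forces `a ∈ (ϖ^t)`: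
`|a|^N ≤ |ϖ|^{t'} ≤ (|ϖ|^t)^N`.  This is the bookkeeping "`θ(T)^{q+1} ≡ 0 (p^{(q+1)t})` hence
`θ(T) ≡ 0 (p^t)`" of the printed continuity argument. [folklore] -/
theorem mem_span_pow_of_pow_mem_span_pow {F : Type*} [Field F] {Γ₀ : Type*}
    [LinearOrderedCommGroupWithZero Γ₀] {v : Valuation F Γ₀} {O : Type*} [CommRing O] [Algebra O F]
    (hv : v.Integers O) (ϖ : O) {N t t' : ℕ} (hN : N ≠ 0) (ht : N * t ≤ t') {a : O}
    (h : a ^ N ∈ Ideal.span {ϖ ^ t'}) : a ∈ Ideal.span {ϖ ^ t} := by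
  rw [Ideal.mem_span_singleton] at h ⊢
  refine hv.dvd_of_le ?_
  have h' : ϖ ^ (N * t) ∣ a ^ N := (pow_dvd_pow ϖ ht).trans h
  have hle := hv.le_of_dvd h'
  rw [map_pow, map_pow, map_pow, map_pow, mul_comm, pow_mul] at hle
  rwa [map_pow, map_pow, ← pow_le_pow_iff_left₀ zero_le zero_le hN]

/-- **The continuity step over the integers of a valuation** (the shape used for
`k = 𝒪_{ℚ̄_p}` in `bianchi_regularAlgebraicCuspidal_isHeckePoint`): if for every `t` there are
`N ≠ 0`, `t' ≥ N t`, a `k`-module `H` with Hecke endomorphisms `S_j`, a simultaneous eigenvector `c`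
of eigenvalues `χ` with annihilator in `(ϖ^{t'})`, and finitely many pieces of the tower controlling
`H` nilpotently with exponent `N` (`P = 0` on the pieces `⇒ P^N c = 0`), then `χ` is an `𝒪`-point
of `Spf 𝕋(Kᵖ)`. [cite: Scholze2015, §V.4, proofs of Thm. V.4.1 and Cor. V.4.2]
[cite: Emerton2006, §2.2 and §2.3] -/
theorem isHeckePoint_of_nilpotentControl_of_integers {F : Type*} [Field F] {Γ₀ : Type*}
    [LinearOrderedCommGroupWithZero Γ₀] {v : Valuation F Γ₀} [Algebra k F] (hv : v.Integers k)
    (h : ∀ t : ℕ, ∃ (I : Finset TowerIndex) (N t' : ℕ) (H : Type w) (_ : AddCommGroup H)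
      (_ : Module k H) (S : J → Module.End k H) (c : H),
        N ≠ 0 ∧ N * t ≤ t' ∧
        (∀ j, S j c = χ j • c) ∧
        (∀ a : k, a • c = 0 → a ∈ Ideal.span {ϖ ^ t'}) ∧
        ∀ P : FreeAlgebra k J,
          (∀ z ∈ I, FreeAlgebra.lift k (fun j => towerHeckeFamily k ι T ϖ (δ j)) P z = 0) →
            (FreeAlgebra.lift k S P ^ N) c = 0) :
    IsHeckePoint ι T ϖ δ χ := by
  refine isHeckePoint_of_nilpotentControl.{u, v, w} fun t => ?_
  obtain ⟨I, N, t', H, _, _, S, c, hN, ht, hc, hann, hI⟩ := h t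
  exact ⟨I, N, t', H, inferInstance, inferInstance, S, c, hc, hann,
    fun a ha => mem_span_pow_of_pow_mem_span_pow hv ϖ hN ht ha, hI⟩

/-! ### Degenerate towers: no Hecke generators (`J` empty) -/

/-- **The class of a constant function in `H⁰(X_L, M)`.**  For `m ∈ M` the constant function
`gL ↦ m` is `Γ`-invariant, and its class `c ∈ H⁰(X_L, M) = Fun(𝒢 ⧸ L, M)^Γ` (Mathlib
`groupCohomology.H0Iso`) has the annihilator of `m`: `a • c = 0 ↔ a • m = 0`.  (Used to see the
scalars `k/ϖ^t` faithfully inside the pieces of the tower.) [folklore] -/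
theorem _root_.Literature.NumberTheory.Automorphic.ArithmeticQuotient.exists_cohomology_zero_smul_eq_zero_iff
    (k : Type u) [CommRing k] {Γ 𝒢 : Type u} [Group Γ] [Group 𝒢] (ι : Γ →* 𝒢) (L : Subgroup 𝒢)
    (M : Type u) [AddCommGroup M] [Module k M] (m : M) :
    ∃ c : ArithmeticQuotient.cohomology k ι L M 0, ∀ a : k, a • c = 0 ↔ a • m = 0 := by
  let w : (ArithmeticQuotient.coeffRep k ι L M).ρ.invariants :=
    ⟨Function.const _ m, (Representation.mem_invariants _ _).2 fun γ => funext fun c => rfl⟩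
  let e := (groupCohomology.H0Iso (ArithmeticQuotient.coeffRep k ι L M)).toLinearEquiv
  refine ⟨e.symm w, fun a => ?_⟩
  rw [← map_smul, LinearEquiv.map_eq_zero_iff, Subtype.ext_iff, Submodule.coe_smul,
    Submodule.coe_zero]
  constructor
  · intro h
    exact congr_fun h ((1 : 𝒢) : 𝒢 ⧸ L)
  · intro h
    exact funext fun _ => h

/-- **A tower with NO Hecke generators (`J` empty) has every `χ` as a point of `Spf 𝕋(Kᵖ)`**, as
soon as `ϖ` is not a unit: the big Hecke algebra then consists of locally-scalar families, and the
class of the constant function `1` in `H⁰(X_{K(0)}, k/ϖ^{t+1})` is a "Hecke eigenclass" (no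
conditions) with annihilator `(ϖ^{t+1}) ⊆ (ϖ^t)` (`isHeckePoint_of_towerEigenclass`).  This is the
degenerate case (no good place) of statements quantifying over the good places. [folklore] -/
theorem isHeckePoint_of_isEmpty [IsEmpty J] (hϖ : ¬ IsUnit ϖ) : IsHeckePoint ι T ϖ δ χ := by
  refine isHeckePoint_of_towerEigenclass fun t => ?_
  obtain ⟨c, hc⟩ := ArithmeticQuotient.exists_cohomology_zero_smul_eq_zero_iff k ι (T.level 0)
    (modPow k ϖ (t + 1)) 1
  have hsmul : ∀ a : k, a • (1 : modPow k ϖ (t + 1)) = 0 ↔ a ∈ Ideal.span {ϖ ^ (t + 1)} :=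
    fun a => by
      rw [Algebra.smul_def, mul_one, Ideal.Quotient.algebraMap_eq, Ideal.Quotient.eq_zero_iff_mem]
  refine ⟨0, 0, t + 1, c, ⟨fun h0 => hϖ ?_, fun j => isEmptyElim j⟩, fun a ha => ?_⟩
  · have h1 : (1 : k) ∈ Ideal.span {ϖ ^ (t + 1)} :=
      (hsmul 1).1 ((hc 1).1 (by rw [h0, smul_zero]))
    rw [Ideal.mem_span_singleton] at h1
    exact isUnit_of_dvd_one ((dvd_pow_self ϖ t.succ_ne_zero).trans h1)
  · exact Ideal.span_singleton_le_span_singleton.2 (pow_dvd_pow ϖ t.le_succ)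
      ((hsmul a).1 ((hc a).1 ha))

/-! ### The degenerate case `0 ∈ S₀` of `bianchi_regularAlgebraicCuspidal_isHeckePoint` -/

/-- `p` is not a unit of `𝒪_{ℚ̄_p}` (its valuation is `1/p < 1`). [folklore] -/
theorem not_isUnit_natCast_valuationSubring_padicAlgCl (p : ℕ) [Fact p.Prime] :
    ¬ IsUnit (((p : ℕ) : (PadicAlgCl.valued p).v.valuationSubring)) := by
  rintro ⟨u, hu⟩
  have hp : Valued.v (((u : (PadicAlgCl.valued p).v.valuationSubring) : PadicAlgCl p)) =
      1 / (p : NNReal) := by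
    rw [hu]
    exact PadicAlgCl.valuation_p p
  have hinv : Valued.v (((u⁻¹ : ((PadicAlgCl.valued p).v.valuationSubring)ˣ) :
      (PadicAlgCl.valued p).v.valuationSubring) : PadicAlgCl p) ≤ 1 :=
    ((PadicAlgCl.valued p).v.mem_valuationSubring_iff _).1 (Subtype.mem _)
  have hone : Valued.v (((u : (PadicAlgCl.valued p).v.valuationSubring) : PadicAlgCl p)) *
      Valued.v (((u⁻¹ : ((PadicAlgCl.valued p).v.valuationSubring)ˣ) :
        (PadicAlgCl.valued p).v.valuationSubring) : PadicAlgCl p) = 1 := by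
    rw [← map_mul, ← Subring.coe_mul, ← Units.val_mul, mul_inv_cancel, Units.val_one,
      OneMemClass.coe_one, map_one]
  rw [hp] at hone
  have hp1 : (1 : NNReal) < p := by exact_mod_cast (Fact.out : p.Prime).one_lt
  have hlt : 1 / (p : NNReal) * Valued.v (((u⁻¹ : ((PadicAlgCl.valued p).v.valuationSubring)ˣ) :
      (PadicAlgCl.valued p).v.valuationSubring) : PadicAlgCl p) < 1 := by
    calc 1 / (p : NNReal) * _ ≤ 1 / (p : NNReal) * 1 := mul_le_mul_of_nonneg_left hinv zero_le
      _ < 1 := by rw [mul_one, one_div]; exact inv_lt_one_of_one_lt₀ hp1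
  exact hlt.ne hone

/-- **The degenerate case `0 ∈ S₀` of `bianchi_regularAlgebraicCuspidal_isHeckePoint`.**  If the
finite set `S₀` of "bad rational primes" contains `0`, no finite place is good (`0 ∈ v` for every
`v`), the family of Hecke generators is indexed by an empty type, the tame-level clause only asks
`1 ∈ U₀`, and the conclusion of the named fact holds for `U₀ = GL₂(𝒪̂_K)` and the empty eigenvalue
family by `isHeckePoint_of_isEmpty` (`p` is not a unit of `𝒪_{ℚ̄_p}`).  No hypothesis on `π` is
needed.  (Bookkeeping for the discharge of the named fact; the content is in the case `0 ∉ S₀`.)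
[folklore] -/
theorem bianchi_regularAlgebraicCuspidal_isHeckePoint_of_zero_mem
    (K : Type) [Field K] [NumberField K] (p : ℕ) [Fact p.Prime] (ι : PadicAlgCl p ≃+* ℂ)
    (hcpt : Literature.NumberTheory.Automorphic.isCompact_glFiniteIntegralLevel 2 K)
    (π : Literature.NumberTheory.Automorphic.CuspidalAutomorphicRepData 2 K hcpt)
    (S₀ : Finset ℕ) (h0 : (0 : ℕ) ∈ S₀) :
    ∃ U₀ : Subgroup (GL (Fin 2) (IsDedekindDomain.FiniteAdeleRing (NumberField.RingOfIntegers K) K)),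
      IsOpen (U₀ : Set (GL (Fin 2) (IsDedekindDomain.FiniteAdeleRing (NumberField.RingOfIntegers K) K))) ∧
      U₀ ≤ Literature.NumberTheory.Automorphic.glFiniteIntegralLevel 2 K ∧
      (∀ g ∈ Literature.NumberTheory.Automorphic.glFiniteIntegralLevel 2 K,
        (∀ v : IsDedekindDomain.HeightOneSpectrum (NumberField.RingOfIntegers K),
          ¬ (∀ ℓ ∈ S₀, ((ℓ : ℕ) : NumberField.RingOfIntegers K) ∉ v.asIdeal) →
          ∀ i j : Fin 2,
            ((g : Matrix (Fin 2) (Fin 2)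
              (IsDedekindDomain.FiniteAdeleRing (NumberField.RingOfIntegers K) K)) i j) v =
            (1 : Matrix (Fin 2) (Fin 2) (v.adicCompletion K)) i j) → g ∈ U₀) ∧
      ∀ (ϖ : ∀ v : IsDedekindDomain.HeightOneSpectrum (NumberField.RingOfIntegers K),
          (v.adicCompletion K)ˣ),
        (∀ v : IsDedekindDomain.HeightOneSpectrum (NumberField.RingOfIntegers K),
          Valued.v ((ϖ v : (v.adicCompletion K)ˣ) : v.adicCompletion K) = WithZero.exp (-1 : ℤ)) →
        ∃ b : {v : IsDedekindDomain.HeightOneSpectrum (NumberField.RingOfIntegers K) //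
              ∀ ℓ ∈ S₀, ((ℓ : ℕ) : NumberField.RingOfIntegers K) ∉ v.asIdeal} → ℕ →
            (PadicAlgCl.valued p).v.valuationSubring,
          (∀ (v : IsDedekindDomain.HeightOneSpectrum (NumberField.RingOfIntegers K))
              (hv : ∀ ℓ ∈ S₀, ((ℓ : ℕ) : NumberField.RingOfIntegers K) ∉ v.asIdeal)
              (α : Multiset ℂ), π.1.HasSatakeParamAt v α →
            ι ((b ⟨v, hv⟩ 1 : (PadicAlgCl.valued p).v.valuationSubring) : PadicAlgCl p) =
                (((Real.sqrt (v.residueCard : ℝ) : ℝ) : ℂ)) * α.esymm 1 ∧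
            ι ((b ⟨v, hv⟩ 2 : (PadicAlgCl.valued p).v.valuationSubring) : PadicAlgCl p) =
                α.esymm 2) ∧
          Literature.NumberTheory.Automorphic.IsHeckePoint
            (Matrix.GeneralLinearGroup.map (n := Fin 2)
              (algebraMap K (IsDedekindDomain.FiniteAdeleRing (NumberField.RingOfIntegers K) K)))
            (Literature.NumberTheory.Automorphic.LevelTower.ofSeq U₀ (fun r : ℕ =>
              (Literature.NumberTheory.Automorphic.principalCongruenceLevel 2 K
                (Ideal.span {((p : ℕ) : NumberField.RingOfIntegers K)} ^ r)).map
                (Literature.NumberTheory.Automorphic.GLn.sndHom 2 K)))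
            ((p : ℕ) : (PadicAlgCl.valued p).v.valuationSubring)
            (fun j : {v : IsDedekindDomain.HeightOneSpectrum (NumberField.RingOfIntegers K) //
                  ∀ ℓ ∈ S₀, ((ℓ : ℕ) : NumberField.RingOfIntegers K) ∉ v.asIdeal} × Fin 2 =>
              Literature.NumberTheory.Automorphic.GLn.sndHom 2 K
                (Literature.NumberTheory.Automorphic.heckeDiagAt 2 K j.1.1 (ϖ j.1.1) (j.2.val + 1)))
            (fun j => b j.1 (j.2.val + 1)) := by
  have hbad : ∀ v : IsDedekindDomain.HeightOneSpectrum (NumberField.RingOfIntegers K),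
      ¬ (∀ ℓ ∈ S₀, ((ℓ : ℕ) : NumberField.RingOfIntegers K) ∉ v.asIdeal) := fun v hv =>
    hv 0 h0 (by rw [Nat.cast_zero]; exact Ideal.zero_mem _)
  haveI : IsEmpty {v : IsDedekindDomain.HeightOneSpectrum (NumberField.RingOfIntegers K) //
      ∀ ℓ ∈ S₀, ((ℓ : ℕ) : NumberField.RingOfIntegers K) ∉ v.asIdeal} :=
    ⟨fun v => hbad v.1 v.2⟩
  refine ⟨Literature.NumberTheory.Automorphic.glFiniteIntegralLevel 2 K,
    Literature.NumberTheory.Automorphic.isOpen_glFiniteIntegralLevel 2 K, le_rfl,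
    fun g hg _ => hg, fun ϖ _ => ⟨fun _ _ => 0, fun v hv => (hbad v hv).elim, ?_⟩⟩
  exact isHeckePoint_of_isEmpty (not_isUnit_natCast_valuationSubring_padicAlgCl p)

end Literature.NumberTheory.Automorphic
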